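import Summits.BirchSwinnertonDyer.BirchSwinnertonDyer.Theorems.ResidualThetaTransportAtTwoResidualSignedLambdaLowerCMAtTwoPlusValueArith
import Literature.NumberTheory.EllipticCurves.CyclotomicLayerThetaKummer
import Literature.NumberTheory.EllipticCurves.Sprung2012.ColemanMaps
import Literature.NumberTheory.GaloisRepresentations.ContinuousH1
import Literature.NumberTheory.EllipticCurves.H1UnramifiedFinite
import HarnessLib

/-!
# S2 interior: the plus value `(t(2^k Q) mod 2^k)·2^{-k}` of a Selmer class does NOT depend on the Kummer representative `(φ, Q, k)`
# (Kummer injectivity through the transport `Θ`, read on tower points)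

Route `ResidualThetaTransportAtTwo` (RTT), crux RSL_g `ResidualSignedLambdaLowerCMAtTwo` (stmt-BirchSwinnertonDyer-22608); seat `prover-bsd-wall-rtt-p2` g17
(`--supports`, closes nothing). THEOREMS ONLY. The well-definedness half of stub S2 `stub_plusColemanO` of skeleton `onepair` (memo
`Cruxes/ResidualSignedLambdaLowerCMAtTwo/V2A-PINS-AND-ENTRY-g17.md` §6). BSD is not proved by any of this.

* `exists_pow_smul_theta_eq_zero` — every `a ∈ A_ρ` is killed by some `p^e` (its Θ-image lies in `(E[p^∞])^r`).
* `sub_sub_mem_localTowerPointsOfEmb` — two Kummer representatives `(φ, Q)`, `(φ', Q')` of ONE class over `Γ_∞ = ker κ` with the Θ-Kummer formula at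
  `v` differ by `Q_i − Q'_i − ι_*(Θ a)_i ∈ E(ℚ_{∞,v})` (a tower point), where `φ − φ' = ∂a`.
* **`levelValue_eq_of_kummerData`** — hence for every additive `t : (Fin r → E(ℚ_{∞,v})) →+ ℤ_p` the level values agree:
  `(t(p^k Q) mod p^k)·p^{-k} = (t(p^{k'} Q') mod p^{k'})·p^{-k'}` in `ℚ/ℤ` (`PlusValue.levelValue_eq_of_pow_mul_sub_mem`, p687453).

References: [Kobayashi2003] (8.23) (p. 18); [MilneADT2006] Ch. I §6 (Kummer pairing); [SilvermanAEC2009] VIII §2 (Kummer sequence).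
-/

set_option autoImplicit false
-- the Theorems namespace of this sub repeats the summit name by design (D-0017 nested layout)
set_option linter.dupNamespace false

noncomputable section

open scoped Classical

namespace Summit.BirchSwinnertonDyer.BirchSwinnertonDyer.Theorems.PlusValue

open NumberField Field IsDedekindDomain WeierstrassCurve Literature.NumberTheory.EllipticCurves
  Literature.NumberTheory.EllipticCurves.GreenbergSelmer Literature.NumberTheory.GaloisRepresentations
  Literature.NumberTheory.EllipticCurves.Kobayashi2003 Literature.NumberTheory.EllipticCurves.Sprung2012

variable {p : ℕ} [Fact p.Prime] {S : Set (PadicAlgCl p)} {d : ℕ} {ρ : FramedGaloisRep ℚ ↥(padicCoeffIntegers S) d}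
  (W : WeierstrassCurve ℚ) {r : ℕ} (Θ : Cofree ρ ↥(padicCoeffField S) ≃+ (Fin r → ↥(W.geomPrimaryTorsion p)))
  (κ : ZpExtension ℚ p) (v : HeightOneSpectrum (𝓞 ℚ))

/-- Every `a ∈ A_ρ` is killed by a power of `p` (read through `Θ : A_ρ ≃ (E[p^∞])^r`). [cite: SilvermanAEC2009, III §7] -/
theorem exists_pow_smul_theta_eq_zero (a : Cofree ρ ↥(padicCoeffField S)) :
    ∃ e : ℕ, ∀ i : Fin r, (p ^ e) • ((Θ a i : ↥(W.geomPrimaryTorsion p)) : W.geomPoints) = 0 := by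
  have h : ∀ i : Fin r, ∃ e : ℕ, (p ^ e) • ((Θ a i : ↥(W.geomPrimaryTorsion p)) : W.geomPoints) = 0 := fun i ↦ by
    obtain ⟨e, he⟩ := (AddCommGroup.mem_primaryComponent).1 (Θ a i).2
    exact ⟨e, he⟩
  choose e he using h
  refine ⟨Finset.univ.sup e, fun i ↦ ?_⟩
  obtain ⟨c, hc⟩ := Nat.exists_eq_add_of_le (Finset.le_sup (f := e) (Finset.mem_univ i))
  rw [hc, pow_add, mul_comm, mul_smul, he i, smul_zero]

/-- **Two Kummer representatives of one class differ by a tower point.** If `φ, φ'` are cocycles on `Γ_∞ = ker κ` with the same class and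
`Q, Q'` satisfy the Θ-Kummer formula at `v` for `φ, φ'` respectively, and `φ − φ' = ∂a`, then `Q_i − Q'_i − ι_*(Θ a)_i` is fixed by
`U_∞ = Gal(ℚ̄_v/ℚ_{∞,v})`, i.e. lies in `E(ℚ_{∞,v}) = localTowerPointsOfEmb`. [cite: SilvermanAEC2009, VIII §2] [cite: MilneADT2006, Ch. I §6] -/
theorem sub_sub_mem_localTowerPointsOfEmb
    (hΘ : ∀ (δ : absoluteGaloisGroup (v.adicCompletion ℚ)) (m : Cofree ρ ↥(padicCoeffField S)) (i : Fin r),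
      Θ (resGalOfEmb (closureEmb (K := ℚ) (v.adicCompletion ℚ)) δ • m) i =
        resGalOfEmb (closureEmb (K := ℚ) (v.adicCompletion ℚ)) δ • Θ m i)
    (φ φ' : contOneCocycles (discreteTopRep ↥κ.kerSubgroup (Cofree ρ ↥(padicCoeffField S))))
    (a : Cofree ρ ↥(padicCoeffField S))
    (ha : ∀ g, φ.1 g - φ'.1 g = g • a - a)
    (Q Q' : Fin r → localPoints W (v.adicCompletion ℚ))
    (hK : ∀ (τ : ↥(localSubgroupOfEmb κ.kerSubgroup (closureEmb (K := ℚ) (v.adicCompletion ℚ)))) (i : Fin r),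
      pointsMapOfEmb W (closureEmb (K := ℚ) (v.adicCompletion ℚ))
        ((Θ (φ.1 (resGalSubgroupOfEmb κ.kerSubgroup (closureEmb (K := ℚ) (v.adicCompletion ℚ)) τ)) i : ↥(W.geomPrimaryTorsion p)) : W.geomPoints) =
        (τ : absoluteGaloisGroup (v.adicCompletion ℚ)) • Q i - Q i)
    (hK' : ∀ (τ : ↥(localSubgroupOfEmb κ.kerSubgroup (closureEmb (K := ℚ) (v.adicCompletion ℚ)))) (i : Fin r),
      pointsMapOfEmb W (closureEmb (K := ℚ) (v.adicCompletion ℚ))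
        ((Θ (φ'.1 (resGalSubgroupOfEmb κ.kerSubgroup (closureEmb (K := ℚ) (v.adicCompletion ℚ)) τ)) i : ↥(W.geomPrimaryTorsion p)) : W.geomPoints) =
        (τ : absoluteGaloisGroup (v.adicCompletion ℚ)) • Q' i - Q' i)
    (i : Fin r) :
    Q i - Q' i - pointsMapOfEmb W (closureEmb (K := ℚ) (v.adicCompletion ℚ)) ((Θ a i : ↥(W.geomPrimaryTorsion p)) : W.geomPoints) ∈
      localTowerPointsOfEmb κ (closureEmb (K := ℚ) (v.adicCompletion ℚ)) W := by
  rw [mem_localTowerPointsOfEmb_iff]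
  intro τ hτ
  have h1 := hK ⟨τ, hτ⟩ i
  have h2 := hK' ⟨τ, hτ⟩ i
  -- `Θ(φ g − φ' g)_i = Θ(g•a − a)_i = (res τ)•(Θ a)_i − (Θ a)_i`
  have h3 : ((Θ (φ.1 (resGalSubgroupOfEmb κ.kerSubgroup (closureEmb (K := ℚ) (v.adicCompletion ℚ)) ⟨τ, hτ⟩)) i : ↥(W.geomPrimaryTorsion p)) : W.geomPoints) -
      ((Θ (φ'.1 (resGalSubgroupOfEmb κ.kerSubgroup (closureEmb (K := ℚ) (v.adicCompletion ℚ)) ⟨τ, hτ⟩)) i : ↥(W.geomPrimaryTorsion p)) : W.geomPoints) =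
      resGalOfEmb (closureEmb (K := ℚ) (v.adicCompletion ℚ)) τ • ((Θ a i : ↥(W.geomPrimaryTorsion p)) : W.geomPoints) -
        ((Θ a i : ↥(W.geomPrimaryTorsion p)) : W.geomPoints) := by
    rw [← AddSubgroupClass.coe_sub, ← Pi.sub_apply, ← map_sub, ha, map_sub, Pi.sub_apply, AddSubgroupClass.coe_sub]
    congr 1
    have : ((resGalSubgroupOfEmb κ.kerSubgroup (closureEmb (K := ℚ) (v.adicCompletion ℚ)) ⟨τ, hτ⟩ : ↥κ.kerSubgroup) •
        a) = resGalOfEmb (closureEmb (K := ℚ) (v.adicCompletion ℚ)) τ • a := rfl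
    rw [this, hΘ]
    rfl
  have h4 := congrArg (pointsMapOfEmb W (closureEmb (K := ℚ) (v.adicCompletion ℚ))) h3
  rw [map_sub, h1, h2, map_sub, pointsMapOfEmb_smul] at h4
  -- `(τQ − Q) − (τQ' − Q') = τP − P` ⟹ `τ(Q − Q' − P) = Q − Q' − P`
  rw [smul_sub, smul_sub]
  have h5 : τ • Q i - τ • Q' i - τ • pointsMapOfEmb W (closureEmb (K := ℚ) (v.adicCompletion ℚ)) ((Θ a i : ↥(W.geomPrimaryTorsion p)) : W.geomPoints) -
      (Q i - Q' i - pointsMapOfEmb W (closureEmb (K := ℚ) (v.adicCompletion ℚ)) ((Θ a i : ↥(W.geomPrimaryTorsion p)) : W.geomPoints)) = 0 := by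
    have := sub_eq_zero.mpr h4
    rw [← this]
    abel
  exact sub_eq_zero.mp h5

/-- **The plus value does not depend on the Kummer representative.** For a class `y ∈ H¹(Γ_∞, A_ρ)` and two data `(φ, Q, k)`, `(φ', Q', k')` —
cocycles representing `y`, tuples of points with `p^k Q_i, p^{k'} Q'_i ∈ E(ℚ_{∞,v})` and the Θ-Kummer formula at `v` — every additive
`t : (Fin r → E(ℚ_{∞,v})) →+ ℤ_p` gives the same level value: `(t(p^kQ) mod p^k)·p^{-k} = (t(p^{k'}Q') mod p^{k'})·p^{-k'}` in `ℚ/ℤ`.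
Proof: `φ − φ' = ∂a` (`oneCocycleClass_eq_zero_iff`), `p^e a = 0`, the difference tuple `R = Q − Q' − ι_*Θa` is a tower point, and
`p^{k'+e}·p^kQ − p^{k+e}·p^{k'}Q' = p^{k+k'+e} R`, so `PlusValue.levelValue_eq_of_pow_mul_sub_mem` applies. [cite: Kobayashi2003, (8.23) (p. 18)]
[cite: MilneADT2006, Ch. I §6] -/
theorem levelValue_eq_of_kummerData
    (hΘ : ∀ (δ : absoluteGaloisGroup (v.adicCompletion ℚ)) (m : Cofree ρ ↥(padicCoeffField S)) (i : Fin r),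
      Θ (resGalOfEmb (closureEmb (K := ℚ) (v.adicCompletion ℚ)) δ • m) i =
        resGalOfEmb (closureEmb (K := ℚ) (v.adicCompletion ℚ)) δ • Θ m i)
    (t : (Fin r → ↥(localTowerPointsOfEmb κ (closureEmb (K := ℚ) (v.adicCompletion ℚ)) W)) →+ ℤ_[p])
    (φ φ' : contOneCocycles (discreteTopRep ↥κ.kerSubgroup (Cofree ρ ↥(padicCoeffField S))))
    (hφ : oneCocycleClass _ φ = oneCocycleClass _ φ')
    (Q Q' : Fin r → localPoints W (v.adicCompletion ℚ)) (k k' : ℕ)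
    (hQ : ∀ i, (p ^ k) • Q i ∈ localTowerPointsOfEmb κ (closureEmb (K := ℚ) (v.adicCompletion ℚ)) W)
    (hQ' : ∀ i, (p ^ k') • Q' i ∈ localTowerPointsOfEmb κ (closureEmb (K := ℚ) (v.adicCompletion ℚ)) W)
    (hK : ∀ (τ : ↥(localSubgroupOfEmb κ.kerSubgroup (closureEmb (K := ℚ) (v.adicCompletion ℚ)))) (i : Fin r),
      pointsMapOfEmb W (closureEmb (K := ℚ) (v.adicCompletion ℚ))
        ((Θ (φ.1 (resGalSubgroupOfEmb κ.kerSubgroup (closureEmb (K := ℚ) (v.adicCompletion ℚ)) τ)) i : ↥(W.geomPrimaryTorsion p)) : W.geomPoints) =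
        (τ : absoluteGaloisGroup (v.adicCompletion ℚ)) • Q i - Q i)
    (hK' : ∀ (τ : ↥(localSubgroupOfEmb κ.kerSubgroup (closureEmb (K := ℚ) (v.adicCompletion ℚ)))) (i : Fin r),
      pointsMapOfEmb W (closureEmb (K := ℚ) (v.adicCompletion ℚ))
        ((Θ (φ'.1 (resGalSubgroupOfEmb κ.kerSubgroup (closureEmb (K := ℚ) (v.adicCompletion ℚ)) τ)) i : ↥(W.geomPrimaryTorsion p)) : W.geomPoints) =
        (τ : absoluteGaloisGroup (v.adicCompletion ℚ)) • Q' i - Q' i) :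
    ((PadicInt.toZModPow k (t (fun i ↦ ⟨(p ^ k) • Q i, hQ i⟩))).val • ((((p : ℚ) ^ k)⁻¹ : ℚ) : AddCircle (1 : ℚ)) : AddCircle (1 : ℚ)) =
      (PadicInt.toZModPow k' (t (fun i ↦ ⟨(p ^ k') • Q' i, hQ' i⟩))).val • ((((p : ℚ) ^ k')⁻¹ : ℚ) : AddCircle (1 : ℚ)) := by
  -- `φ − φ' = ∂a`
  have h0 : oneCocycleClass _ (φ - φ') = 0 := by rw [oneCocycleClass_sub, hφ, sub_self]
  obtain ⟨a, ha⟩ := (oneCocycleClass_eq_zero_iff _ _).mp h0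
  have ha' : ∀ g : ↥κ.kerSubgroup, φ.1 g - φ'.1 g = g • a - a := fun g ↦ ha g
  obtain ⟨e, he⟩ := exists_pow_smul_theta_eq_zero W Θ a
  -- the tower point `R = Q − Q' − P`, `P_i := ι_*(Θ a)_i` (opaque name with its defining equations)
  obtain ⟨P, hP⟩ : ∃ P : Fin r → localPoints W (v.adicCompletion ℚ), ∀ i,
      P i = pointsMapOfEmb W (closureEmb (K := ℚ) (v.adicCompletion ℚ)) ((Θ a i : ↥(W.geomPrimaryTorsion p)) : W.geomPoints) :=
    ⟨_, fun _ ↦ rfl⟩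
  have hR : ∀ i, Q i - Q' i - P i ∈ localTowerPointsOfEmb κ (closureEmb (K := ℚ) (v.adicCompletion ℚ)) W := fun i ↦ by
    rw [hP i]
    exact sub_sub_mem_localTowerPointsOfEmb W Θ κ v hΘ φ φ' a ha' Q Q' hK hK' i
  have hPe : ∀ i, (p ^ e) • P i = 0 := fun i ↦ by rw [hP i, ← map_nsmul, he i, map_zero]
  have e1 : p ^ (k' + e) * p ^ k = p ^ (k + k') * p ^ e := by ring
  have e2 : p ^ (k + e) * p ^ k' = p ^ (k + k') * p ^ e := by ring
  -- `p^{k'+e} • (p^k Q) − p^{k+e} • (p^{k'} Q') = p^{k+k'+e} • R` in `Fin r → E(ℚ_{∞,v})`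
  have hid : (p ^ (k' + e)) • (fun i ↦ (⟨(p ^ k) • Q i, hQ i⟩ : ↥(localTowerPointsOfEmb κ (closureEmb (K := ℚ) (v.adicCompletion ℚ)) W))) -
      (p ^ (k + e)) • (fun i ↦ (⟨(p ^ k') • Q' i, hQ' i⟩ : ↥(localTowerPointsOfEmb κ (closureEmb (K := ℚ) (v.adicCompletion ℚ)) W))) =
      (p ^ (k + k' + e)) • (fun i ↦ (⟨Q i - Q' i - P i, hR i⟩ : ↥(localTowerPointsOfEmb κ (closureEmb (K := ℚ) (v.adicCompletion ℚ)) W))) := by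
    funext i
    apply Subtype.ext
    simp only [Pi.sub_apply, Pi.smul_apply, AddSubgroupClass.coe_sub, AddSubgroupClass.coe_nsmul]
    rw [smul_sub, smul_sub, pow_add p (k + k') e, mul_smul (p ^ (k + k')) (p ^ e) (P i), hPe i, smul_zero, sub_zero,
      smul_smul, smul_smul, e1, e2]
  have ht := congrArg t hid
  rw [map_sub, map_nsmul, map_nsmul, map_nsmul] at ht
  refine levelValue_eq_of_pow_mul_sub_mem k k' e _ _ ?_
  rw [nsmul_eq_mul, nsmul_eq_mul, nsmul_eq_mul] at ht
  push_cast at ht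
  rw [ht]
  exact Ideal.mul_mem_right _ _ (Ideal.mem_span_singleton_self _)

end Summit.BirchSwinnertonDyer.BirchSwinnertonDyer.Theorems.PlusValue

end
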